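import Mathlib
import Summits.ValiantsHypothesis.ValiantsHypothesis.Theorems.FifoMatchingNNDivisionHardLocalCofactor
import Summits.ValiantsHypothesis.ValiantsHypothesis.Theorems.DivisionGapPerCofactorDegreeReductionStubMonomialStripping
import HarnessLib

/-!
# Route FifoMatching — crux `NNDivisionHard` (stmt-ValiantsHypothesis-21181): ARC ELIMINATION —
# a certificate for `NN_n` carries, for every avoidable arc set `I`, a certificate for the `I`-AVOIDING FACE `NN_n^{¬I}`
# with an `I`-FREE cofactor; cofactors with a MONOMIAL outer `I`-face (e.g. binomial powers `(a x^P + b x^Q)^D`) reduce to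
# the bare face

`…LocalCofactor.lean` proved: if EVERY variable of `h` lies in `I` then `L₊(NN_n^{¬I}) ≤ L₊(NN_n · h) + 1`.  The same
direction `w_I = 𝟙_{I^c}` does more, for an ARBITRARY cofactor: `top_{w_I}(NN_n · h) = NN_n^{¬I} · top_{w_I}(h)` (initial
forms are free and multiplicative over `ℝ≥0`), and the projection `x_e ↦ 1 (e ∈ I)` fixes `NN_n^{¬I}` and sends `top_{w_I}(h)`
to a nonzero `I`-FREE polynomial.  Hence:

* `complexity_avoidingFace_mul_top_le` — `L₊(NN_n^{¬I} · top_{w_I} h) ≤ L₊(NN_n · h)`;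
* ★ `freeCofactor_ne_zero`, `freeCofactor_vars`, `complexity_avoidingFace_mul_freeCofactor_le`, `complexity_freeCofactor_le` —
  **`I`-ELIMINATION**: with `g := (top_{w_I} h)|_{x_I := 1}` one has `g ≠ 0`, `vars g ∩ I = ∅`, `L₊(NN_n^{¬I} · g) ≤ L₊(NN_n · h)`
  and `L₊(g) ≤ L₊(h)`.  So `NNDivisionHard` is implied by (and for `I = ∅` is) the division hardness of ANY avoidable face
  `NN_n^{¬I}` against `I`-free cofactors — the arcs of `I` are eliminated from BOTH factors at no cost;
* ★ `complexity_avoidingFace_le_of_top_monomial` — **if the outer `I`-face `top_{w_I} h` is a single monomial `c · x^d` then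
  `L₊(NN_n^{¬I}) ≤ 16 ((2n+1) (L₊(NN_n · h) + 2))²`** (Jukna–Seiwert–Sergeev contraction strips `x^d`, whatever its degree);
* `topComponent_add_eq_left_of_lt` — `top_w (p + q) = p` for `p ≠ 0` `w`-homogeneous of weight `W` and `q` of weights `< W`;
* ★★ `complexity_arcAvoidingFace_le_of_binomialPow` — **BINOMIAL POWERS.**  For `h = (a·x^P + b·x^Q)^D` (`P` a nest-free
  perfect matching, `Q ≠ P` a perfect matching, `a ≠ 0`, any `b`, any `D`) and any arc `e` of `Q` that is not an arc of `P`: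
  `L₊(NN_n^{¬{e}}) ≤ 16 ((2n+1) (L₊(NN_n · h) + 2))²` — in direction `𝟙_{≠ e}` the outer face of `h` is `a^D x^{DP}` alone;
  The companion file `…BinomialPowers.lean` feeds this into the hardness of short-arc-avoiding faces: binomial powers whose
  matchings differ at a short arc are not certificates, for EVERY degree `D` (such cofactors are cheap by repeated squaring,
  torus-homogeneous, spread, of arbitrary degree, and generic for no adjacent / prefix direction when `P △ Q` has no such arc).

HONEST FRAMING: a reduction (arc elimination) and one explicit family for ONE candidate; stmt-21181 stays OPEN (the `I`-free
division hardness of a face is the same kind of problem); nothing here bears on `NNNotVP` or on VP ≠ VNP (NOT proved).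
No definitions, no named facts.
References: Bürgisser 2000 Rem. 2.7 [Burgisser2000]; Jukna–Seiwert–Sergeev 2022 Thm 1 [JuknaSeiwertSergeev2022];
Hrubeš–Yehudayoff 2021 §6 Problem 2 [HrubesYehudayoff2021].
-/

noncomputable section

-- Sub = Summit single-conjunct layout: the duplicated namespace component is mandated by the tree.
set_option linter.dupNamespace false
set_option autoImplicit false

namespace Summit.ValiantsHypothesis.ValiantsHypothesis.Theorems.FifoMatching.NNDivisionHard.ArcElimination

open Finset MvPolynomial Literature.Computability.AlgebraicComplexity
open Summit.ValiantsHypothesis.ValiantsHypothesis.Theorems.ZeroOneTransfer.Negative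
  (topComponent topComponent_mul complexity_topComponent_le topComponent_ne_zero support_topComponent_subset
    coeff_topComponent)
open Summit.ValiantsHypothesis.ValiantsHypothesis.Theorems.FifoMatching.NNDivisionHard.LocalCofactor
  (topComponent_compl_eq aeval_eq_self_of_vars weight_le weight_eq_iff)
open Summit.ValiantsHypothesis.ValiantsHypothesis.Theorems.FifoMatching.NNDivisionHard.LinearTransport
  (eval_one_ne_zero complexity_aeval_le_of_X_or_one vars_aeval_subset)
open Summit.ValiantsHypothesis.ValiantsHypothesis.Theorems.DivisionGap.PerCofactorDegreeReduction.MonomialStripping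
  (complexity_le_of_monomial_mul)
open scoped NNReal BigOperators

variable {n : ℕ}

/-! ### §1 The outer `I`-face of a certificate -/

/-- ★ For an avoidable arc set `I` and ANY cofactor `h`: `L₊(NN_n^{¬I} · top_{𝟙_{I^c}} h) ≤ L₊(NN_n · h)` — the top
`𝟙_{I^c}`-component of the certificate, free for monotone circuits. [cite: Burgisser2000, Rem. 2.7] -/
theorem complexity_avoidingFace_mul_top_le (I : Finset (Fin (2 * n) × Fin (2 * n)))
    (hI : ∃ M ∈ nestFreeMatchings (2 * n), ∀ i ∈ openers M, (i, M i) ∉ I)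
    (h : MvPolynomial (Fin (2 * n) × Fin (2 * n)) ℝ≥0) :
    complexity ((∑ M ∈ (nestFreeMatchings (2 * n)).filter (fun M => ∀ i ∈ openers M, (i, M i) ∉ I),
        arcMonomial ℝ≥0 M) * topComponent (fun e : Fin (2 * n) × Fin (2 * n) => if e ∈ I then 0 else 1) h) ≤
      complexity (nestFreeMatchingPoly n ℝ≥0 * h) := by
  have H := complexity_topComponent_le (fun e : Fin (2 * n) × Fin (2 * n) => if e ∈ I then 0 else 1)
    (nestFreeMatchingPoly n ℝ≥0 * h)
  rw [topComponent_mul, topComponent_compl_eq I hI] at H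
  exact H

/-! ### §2 `I`-elimination: an `I`-free cofactor for the `I`-avoiding face -/

/-- The eliminated cofactor `(top_{𝟙_{I^c}} h)|_{x_I := 1}` is nonzero when `h` is. [folklore] -/
theorem freeCofactor_ne_zero (I : Finset (Fin (2 * n) × Fin (2 * n)))
    {h : MvPolynomial (Fin (2 * n) × Fin (2 * n)) ℝ≥0} (hh : h ≠ 0) :
    aeval (fun e : Fin (2 * n) × Fin (2 * n) => if e ∈ I then (1 : MvPolynomial (Fin (2 * n) × Fin (2 * n)) ℝ≥0) else X e)
      (topComponent (fun e : Fin (2 * n) × Fin (2 * n) => if e ∈ I then 0 else 1) h) ≠ 0 := by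
  set q := topComponent (fun e : Fin (2 * n) × Fin (2 * n) => if e ∈ I then 0 else 1) h with hq
  set a : Fin (2 * n) × Fin (2 * n) → MvPolynomial (Fin (2 * n) × Fin (2 * n)) ℝ≥0 :=
    fun e => if e ∈ I then 1 else X e with ha
  have hq0 : q ≠ 0 := topComponent_ne_zero _ hh
  have hcomp : (eval fun _ : Fin (2 * n) × Fin (2 * n) => (1 : ℝ≥0)).comp (aeval a).toRingHom =
      eval fun _ : Fin (2 * n) × Fin (2 * n) => (1 : ℝ≥0) := by
    refine ringHom_ext (fun r => by simp) fun e => ?_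
    by_cases he : e ∈ I <;> simp [a, he]
  intro h0
  have h1 : eval (fun _ => (1 : ℝ≥0)) (aeval a q) = eval (fun _ => (1 : ℝ≥0)) q := by
    have := RingHom.congr_fun hcomp q
    simpa [RingHom.comp_apply] using this
  rw [h0, map_zero] at h1
  exact eval_one_ne_zero hq0 h1.symm

/-- The eliminated cofactor is `I`-free. [folklore] -/
theorem freeCofactor_vars (I : Finset (Fin (2 * n) × Fin (2 * n)))
    (h : MvPolynomial (Fin (2 * n) × Fin (2 * n)) ℝ≥0) :
    ∀ e ∈ (aeval (fun e : Fin (2 * n) × Fin (2 * n) =>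
        if e ∈ I then (1 : MvPolynomial (Fin (2 * n) × Fin (2 * n)) ℝ≥0) else X e)
      (topComponent (fun e : Fin (2 * n) × Fin (2 * n) => if e ∈ I then 0 else 1) h)).vars, e ∉ I := by
  intro e he
  have hsub := vars_aeval_subset {e : Fin (2 * n) × Fin (2 * n) | e ∉ I}
    (fun e : Fin (2 * n) × Fin (2 * n) => if e ∈ I then (1 : MvPolynomial (Fin (2 * n) × Fin (2 * n)) ℝ≥0) else X e)
    (fun e he => by have : e ∉ I := he; simp [this]) (fun e he => by
      have : e ∈ I := by simpa using he
      simp [this])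
    (topComponent (fun e : Fin (2 * n) × Fin (2 * n) => if e ∈ I then 0 else 1) h)
  exact hsub (Finset.mem_coe.2 he)

/-- The substitution `x_I := 1` fixes the `I`-avoiding face. [folklore] -/
theorem aeval_avoidingFace_eq (I : Finset (Fin (2 * n) × Fin (2 * n))) :
    aeval (fun e : Fin (2 * n) × Fin (2 * n) =>
        if e ∈ I then (1 : MvPolynomial (Fin (2 * n) × Fin (2 * n)) ℝ≥0) else X e)
      (∑ M ∈ (nestFreeMatchings (2 * n)).filter (fun M => ∀ i ∈ openers M, (i, M i) ∉ I), arcMonomial ℝ≥0 M) =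
      ∑ M ∈ (nestFreeMatchings (2 * n)).filter (fun M => ∀ i ∈ openers M, (i, M i) ∉ I), arcMonomial ℝ≥0 M := by
  classical
  refine aeval_eq_self_of_vars _ fun e he => ?_
  obtain ⟨m, hm, hem⟩ := (mem_vars_iff_mem_support e).1 he
  rw [support_sum_arcMonomial ((Finset.filter_subset _ _).trans nestFreeMatchings_subset_perfectMatchings),
    Finset.mem_image] at hm
  obtain ⟨M, hM, rfl⟩ := hm
  obtain ⟨-, hMI⟩ := Finset.mem_filter.1 hM
  have he' : e ∉ I := by
    obtain ⟨i, j⟩ := e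
    have hij := Finsupp.mem_support_iff.1 hem
    rw [arcExponent_apply] at hij
    split_ifs at hij with hc
    · rw [← hc.2]; exact hMI i (mem_openers.2 hc.1)
    · exact absurd rfl hij
  simp [he']

/-- ★ **`I`-ELIMINATION, certificate side**: `L₊(NN_n^{¬I} · g) ≤ L₊(NN_n · h)` for the `I`-free cofactor
`g = (top_{𝟙_{I^c}} h)|_{x_I := 1}`. [cite: Burgisser2000, Rem. 2.7] -/
theorem complexity_avoidingFace_mul_freeCofactor_le (I : Finset (Fin (2 * n) × Fin (2 * n)))
    (hI : ∃ M ∈ nestFreeMatchings (2 * n), ∀ i ∈ openers M, (i, M i) ∉ I)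
    (h : MvPolynomial (Fin (2 * n) × Fin (2 * n)) ℝ≥0) :
    complexity ((∑ M ∈ (nestFreeMatchings (2 * n)).filter (fun M => ∀ i ∈ openers M, (i, M i) ∉ I),
        arcMonomial ℝ≥0 M) *
      aeval (fun e : Fin (2 * n) × Fin (2 * n) =>
          if e ∈ I then (1 : MvPolynomial (Fin (2 * n) × Fin (2 * n)) ℝ≥0) else X e)
        (topComponent (fun e : Fin (2 * n) × Fin (2 * n) => if e ∈ I then 0 else 1) h)) ≤
      complexity (nestFreeMatchingPoly n ℝ≥0 * h) := by
  set a : Fin (2 * n) × Fin (2 * n) → MvPolynomial (Fin (2 * n) × Fin (2 * n)) ℝ≥0 :=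
    fun e => if e ∈ I then 1 else X e with ha_def
  have ha : ∀ e, a e = X e ∨ a e = 1 := fun e => by by_cases he : e ∈ I <;> simp [a, he]
  have H1 := complexity_aeval_le_of_X_or_one a ha
    ((∑ M ∈ (nestFreeMatchings (2 * n)).filter (fun M => ∀ i ∈ openers M, (i, M i) ∉ I), arcMonomial ℝ≥0 M) *
      topComponent (fun e : Fin (2 * n) × Fin (2 * n) => if e ∈ I then 0 else 1) h)
  rw [map_mul, show aeval a (∑ M ∈ (nestFreeMatchings (2 * n)).filter (fun M => ∀ i ∈ openers M, (i, M i) ∉ I),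
      arcMonomial ℝ≥0 M) = _ from aeval_avoidingFace_eq I] at H1
  exact H1.trans (complexity_avoidingFace_mul_top_le I hI h)

/-- ★ **`I`-ELIMINATION, cofactor side**: `L₊(g) ≤ L₊(h)` for `g = (top_{𝟙_{I^c}} h)|_{x_I := 1}`.
[cite: Burgisser2000, Rem. 2.7] -/
theorem complexity_freeCofactor_le (I : Finset (Fin (2 * n) × Fin (2 * n)))
    (h : MvPolynomial (Fin (2 * n) × Fin (2 * n)) ℝ≥0) :
    complexity (aeval (fun e : Fin (2 * n) × Fin (2 * n) =>
          if e ∈ I then (1 : MvPolynomial (Fin (2 * n) × Fin (2 * n)) ℝ≥0) else X e)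
        (topComponent (fun e : Fin (2 * n) × Fin (2 * n) => if e ∈ I then 0 else 1) h)) ≤ complexity h := by
  refine (complexity_aeval_le_of_X_or_one _ (fun e => ?_) _).trans (complexity_topComponent_le _ h)
  by_cases he : e ∈ I <;> simp [he]

/-! ### §3 A monomial outer face reduces the certificate to the bare face -/

/-- ★ **If the outer `I`-face of the cofactor is a single monomial `c · x^d`, then
`L₊(NN_n^{¬I}) ≤ 16 ((2n+1) (L₊(NN_n · h) + 2))²`** (divide by `c`, then strip `x^d` by the Jukna–Seiwert–Sergeev contraction).
[cite: JuknaSeiwertSergeev2022, Thm 1] -/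
theorem complexity_avoidingFace_le_of_top_monomial (I : Finset (Fin (2 * n) × Fin (2 * n)))
    (hI : ∃ M ∈ nestFreeMatchings (2 * n), ∀ i ∈ openers M, (i, M i) ∉ I)
    {h : MvPolynomial (Fin (2 * n) × Fin (2 * n)) ℝ≥0} {d : (Fin (2 * n) × Fin (2 * n)) →₀ ℕ} {c : ℝ≥0} (hc : c ≠ 0)
    (htop : topComponent (fun e : Fin (2 * n) × Fin (2 * n) => if e ∈ I then 0 else 1) h = monomial d c) :
    complexity (∑ M ∈ (nestFreeMatchings (2 * n)).filter (fun M => ∀ i ∈ openers M, (i, M i) ∉ I), arcMonomial ℝ≥0 M) ≤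
      16 * ((2 * n + 1) * (complexity (nestFreeMatchingPoly n ℝ≥0 * h) + 2)) ^ 2 := by
  set F := ∑ M ∈ (nestFreeMatchings (2 * n)).filter (fun M => ∀ i ∈ openers M, (i, M i) ∉ I), arcMonomial ℝ≥0 M
    with hF
  have H := complexity_avoidingFace_mul_top_le I hI h
  rw [htop] at H
  -- divide by `c`
  have hsplit : monomial d (1 : ℝ≥0) * F = (F * monomial d c) * C c⁻¹ := by
    have hcc : C c * C c⁻¹ = (1 : MvPolynomial (Fin (2 * n) × Fin (2 * n)) ℝ≥0) := by
      rw [← C_mul, mul_inv_cancel₀ hc, C_1]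
    calc monomial d (1 : ℝ≥0) * F = (C c * C c⁻¹) * (monomial d 1 * F) := by rw [hcc, one_mul]
      _ = (F * (C c * monomial d 1)) * C c⁻¹ := by ring
      _ = (F * monomial d c) * C c⁻¹ := by rw [C_mul_monomial, mul_one]
  have H1 : complexity (monomial d (1 : ℝ≥0) * F) ≤ complexity (nestFreeMatchingPoly n ℝ≥0 * h) + 1 := by
    calc complexity (monomial d (1 : ℝ≥0) * F) = complexity ((F * monomial d c) * C c⁻¹) := by rw [hsplit]
      _ ≤ complexity (F * monomial d c) + complexity (C c⁻¹ : MvPolynomial (Fin (2 * n) × Fin (2 * n)) ℝ≥0) + 1 :=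
          complexity_mul_le_holds _ _
      _ = complexity (F * monomial d c) + 1 := by rw [complexity_C_holds, add_zero]
      _ ≤ complexity (nestFreeMatchingPoly n ℝ≥0 * h) + 1 := by gcongr
  have H2 := complexity_le_of_monomial_mul (2 * n) d F
  calc complexity F ≤ 16 * ((2 * n + 1) * (complexity (monomial d (1 : ℝ≥0) * F) + 1)) ^ 2 := H2
    _ ≤ 16 * ((2 * n + 1) * (complexity (nestFreeMatchingPoly n ℝ≥0 * h) + 1 + 1)) ^ 2 := by gcongr

/-! ### §4 Binomial powers -/

/-- `top_w (p + q) = p` when `p ≠ 0` is `w`-homogeneous of weight `W` and every monomial of `q` has weight `< W`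
(no cancellation over `ℝ≥0`). [folklore] -/
theorem topComponent_add_eq_left_of_lt {σ : Type*} (w : σ → ℕ) {p q : MvPolynomial σ ℝ≥0} {W : ℕ} (hp : p ≠ 0)
    (hpW : IsWeightedHomogeneous w p W) (hq : ∀ d ∈ q.support, Finsupp.weight w d < W) :
    topComponent w (p + q) = p := by
  classical
  -- the weighted degree of `p + q` is `W`
  have hdeg : weightedTotalDegree w (p + q) = W := by
    apply le_antisymm
    · refine Finset.sup_le fun d hd => ?_
      have hd' := support_add hd
      rcases Finset.mem_union.1 hd' with h1 | h1
      · exact (hpW (mem_support_iff.1 h1)).le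
      · exact (hq d h1).le
    · obtain ⟨d, hd⟩ := support_nonempty.2 hp
      have hwd : Finsupp.weight w d = W := hpW (mem_support_iff.1 hd)
      have hqd : coeff d q = 0 := by
        by_contra hne
        exact absurd hwd (hq d (mem_support_iff.2 hne)).ne
      have hd2 : d ∈ (p + q).support := by
        rw [mem_support_iff, coeff_add, hqd, add_zero]; exact mem_support_iff.1 hd
      rw [← hwd]
      exact le_weightedTotalDegree w hd2
  refine MvPolynomial.ext _ _ fun d => ?_
  rw [coeff_topComponent, hdeg, coeff_add]
  split_ifs with hwd
  · have hqd : coeff d q = 0 := by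
      by_contra hne
      exact absurd hwd (hq d (mem_support_iff.2 hne)).ne
    rw [hqd, add_zero]
  · by_contra hne
    have hpd : coeff d p ≠ 0 := fun h0 => hne (by rw [h0])
    exact hwd (hpW hpd)

/-- ★★ **BINOMIAL POWERS reduce to a single-arc-avoiding face.**  Let `P` be a nest-free perfect matching, `Q` a perfect
matching, `e = (i, Q i)` an arc of `Q` (`i < Q i`) which is not an arc of `P` (`P i ≠ Q i`), `a ≠ 0`, `b`, `D` arbitrary, and
`h = (a·x^P + b·x^Q)^D`.  Then `L₊(NN_n^{¬{e}}) ≤ 16 ((2n+1) (L₊(NN_n · h) + 2))²`. [cite: JuknaSeiwertSergeev2022, Thm 1] -/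
theorem complexity_arcAvoidingFace_le_of_binomialPow {P Q : Fin (2 * n) → Fin (2 * n)}
    (hP : P ∈ nestFreeMatchings (2 * n)) (hQ : Q ∈ perfectMatchings (2 * n)) {i : Fin (2 * n)} (hi : i < Q i)
    (hPQ : P i ≠ Q i) {a : ℝ≥0} (ha : a ≠ 0) (b : ℝ≥0) (D : ℕ) :
    complexity (∑ M ∈ (nestFreeMatchings (2 * n)).filter (fun M => ∀ j ∈ openers M, (j, M j) ∉ ({(i, Q i)} :
        Finset (Fin (2 * n) × Fin (2 * n)))), arcMonomial ℝ≥0 M) ≤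
      16 * ((2 * n + 1) * (complexity (nestFreeMatchingPoly n ℝ≥0 *
        (C a * arcMonomial ℝ≥0 P + C b * arcMonomial ℝ≥0 Q) ^ D) + 2)) ^ 2 := by
  classical
  set I : Finset (Fin (2 * n) × Fin (2 * n)) := {(i, Q i)} with hI_def
  set w : Fin (2 * n) × Fin (2 * n) → ℕ := fun e => if e ∈ I then 0 else 1 with hw
  have hPM := nestFreeMatchings_subset_perfectMatchings hP
  -- `P` avoids the arc `e = (i, Q i)`
  have hPI : ∀ j ∈ openers P, (j, P j) ∉ I := by
    intro j hj hmem
    rw [hI_def, Finset.mem_singleton, Prod.mk.injEq] at hmem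
    obtain ⟨rfl, h2⟩ := hmem
    exact hPQ h2
  have hI : ∃ M ∈ nestFreeMatchings (2 * n), ∀ j ∈ openers M, (j, M j) ∉ I := ⟨P, hP, hPI⟩
  -- weights: `w(x^P) = n`, `w(x^Q) < n`
  have hwP : Finsupp.weight w (arcExponent P) = n := (weight_eq_iff I hPM).2 hPI
  have hwQ : Finsupp.weight w (arcExponent Q) < n := by
    have hle := weight_le I hQ
    have hne : Finsupp.weight w (arcExponent Q) ≠ n := by
      intro heq
      have := (weight_eq_iff I hQ).1 heq i (mem_openers.2 hi)
      exact this (by rw [hI_def, Finset.mem_singleton])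
    exact lt_of_le_of_ne hle hne
  -- the outer face of the binomial is `a · x^P`
  have hmonP : C a * arcMonomial ℝ≥0 P = monomial (arcExponent P) a := by
    rw [arcMonomial_eq_monomial, C_mul_monomial, mul_one]
  have hmonQ : C b * arcMonomial ℝ≥0 Q = monomial (arcExponent Q) b := by
    rw [arcMonomial_eq_monomial, C_mul_monomial, mul_one]
  have htop1 : topComponent w (C a * arcMonomial ℝ≥0 P + C b * arcMonomial ℝ≥0 Q) = monomial (arcExponent P) a := by
    rw [hmonP, hmonQ]
    refine topComponent_add_eq_left_of_lt w (W := n) ?_ (isWeightedHomogeneous_monomial w _ _ hwP) ?_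
    · rw [Ne, monomial_eq_zero]; exact ha
    · intro d hd
      have hd' := support_monomial_subset hd
      rw [Finset.mem_singleton] at hd'
      rw [hd']; exact hwQ
  have htop : topComponent w ((C a * arcMonomial ℝ≥0 P + C b * arcMonomial ℝ≥0 Q) ^ D) =
      monomial (D • arcExponent P) (a ^ D) := by
    have hpow : ∀ N : ℕ, topComponent w ((C a * arcMonomial ℝ≥0 P + C b * arcMonomial ℝ≥0 Q) ^ N) =
        topComponent w (C a * arcMonomial ℝ≥0 P + C b * arcMonomial ℝ≥0 Q) ^ N := by
      intro N
      induction N with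
      | zero => rw [pow_zero, pow_zero, ← C_1, Summit.ValiantsHypothesis.ValiantsHypothesis.Theorems.ZeroOneTransfer.Negative.topComponent_C]
      | succ N ih => rw [pow_succ, pow_succ, topComponent_mul, ih]
    rw [hpow D, htop1, monomial_pow]
  exact complexity_avoidingFace_le_of_top_monomial I hI (pow_ne_zero D ha) htop

end Summit.ValiantsHypothesis.ValiantsHypothesis.Theorems.FifoMatching.NNDivisionHard.ArcElimination

end
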